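import Summits.HodgeConjecture.HodgeConjecture.Theorems.Ring2AbelianAllAndreIsogenousPencilsFinite
import Summits.HodgeConjecture.HodgeConjecture.Theorems.Ring2AbelianAllAndreIsogenousPencilsRank
import HarnessLib

/-!
# Ring 2 · sub-cell AbelianAll (ALL ABELIAN VARIETIES), André axis, part XXXV-b — ISOGENOUS PENCILS, THE RANK FORM WITHOUT
# `[LocallyQuasiFinite ψ.left]`: the number of lifted classes `r_p` and the lift defect `δ_p` are invariants of the `S`-isogeny
# class of a compact abelian pencil with nothing asked of the surjective `S`-morphism `ψ` (part XXXV-a: `ψ` is finite). FACT-FREE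

HONEST FRAMING (page 1, verbatim): **research route, not a corollary; conditional on HC_CM plus one named
minimal statement.** Cell line: research route conditional on HC_CM; not a corollary; Q11.4-sentence-2 already
refuted in dim ≥ 3. Nothing in this file proves a case of the Hodge conjecture for an abelian variety; `HC_CM`, `HC_AV`
do not occur; no node is born (0 `def`), no named fact is used, no `sorry`; axioms standard; nothing is claimed minimal.

## What this part does

Part XXXIV-d proved `r_p(ψ ≫ f')(t) = r_p(f')(t)` (`finrank_map_algebraicClasses_eq_of_isogenous`) and the equality of lift
defects `δ_p(ψ ≫ f', t) = δ_p(f', t)` (`liftDefect_eq_of_isogenous`) for a surjective `S`-morphism `ψ : 𝒳 ⟶ 𝒳'` of compact pencils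
of abelian varieties of the same relative dimension `d` under the instance hypothesis `[LocallyQuasiFinite ψ.left]`; part XXXV-a
(`Ring2AbelianAllAndreIsogenousPencilsFinite`) proved that such a `ψ` is FINITE (`isFinite_left_of_isogenous`), hence locally
quasi-finite (`locallyQuasiFinite_left_of_isogenous`). This file records the two rank rows hypothesis-free:
`finrank_map_algebraicClasses_eq_of_surjective` (`r_p`) and `liftDefect_eq_of_surjective` (`δ_p`). Separate file only because the
two imports are separate parts. EDGE LABELS: both rows K (kernel, fact-free). Nothing minimal; no case of HC; no node.

References: Andre1996Motifs (§6.3, proof of Lemme 6.3.1, p. 32: «bouger s ou t par G(ℚ) change X_s, X_t en des variétés abéliennes isogènes»); DeligneHodgeII1971 (proof of Lemme 4.4.16, p. 53: «remplaçant X par un schéma abélien isogène»);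
Milne2020HodgeClassesAV (Prop. 1 p. 7);
MumfordAV1970 (§19 Thm. 1); GortzWedhorn2020 (Cor. 12.89).
-/

noncomputable section

set_option linter.dupNamespace false

namespace Summit.HodgeConjecture.HodgeConjecture.Ring2.AbelianAll

open CategoryTheory CategoryTheory.Limits AlgebraicGeometry MonoidalCategory CartesianMonoidalCategory
open Literature.AlgebraicGeometry Literature.AlgebraicGeometry.Motives
open Literature.AlgebraicGeometry.HodgeTheory

variable {𝒳 𝒳' S : SchemeOver ℂ} {d : ℕ} {f' : 𝒳' ⟶ S} {ψ : 𝒳 ⟶ 𝒳'}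
  (hf : IsCompactAbelianPencil (ψ ≫ f') d) (hf' : IsCompactAbelianPencil f' d)

variable [Surjective ψ.left]

include hf hf' in
/-- **ISOGENOUS PENCILS HAVE THE SAME NUMBER OF LIFTED CLASSES, `r_p(ψ ≫ f')(t) = r_p(f')(t)`**, hypothesis-free (part XXXIV-d's
`finrank_map_algebraicClasses_eq_of_isogenous` without `[LocallyQuasiFinite ψ.left]`). FACT-FREE.
[cite: Milne2020HodgeClassesAV, Prop. 1 (p. 7)] [cite: Andre1996Motifs, §6.3 proof of Lemme 6.3.1 (p. 32)] -/
theorem finrank_map_algebraicClasses_eq_of_surjective (t : ComplexPoints S) (p : ℕ) :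
    Module.finrank ℂ ↥((algebraicClasses 𝒳 p).map (complexBetti.map (fiberι (ψ ≫ f') t) (2 * p)).hom) =
      Module.finrank ℂ ↥((algebraicClasses 𝒳' p).map (complexBetti.map (fiberι f' t) (2 * p)).hom) := by
  haveI := locallyQuasiFinite_left_of_isogenous hf hf'
  exact finrank_map_algebraicClasses_eq_of_isogenous hf hf' t p

include hf hf' in
/-- **ISOGENOUS PENCILS HAVE THE SAME LIFT DEFECT `δ_p(ψ ≫ f', t) = δ_p(f', t)`** (additively), hypothesis-free (part XXXIV-d's
`liftDefect_eq_of_isogenous` without `[LocallyQuasiFinite ψ.left]`). FACT-FREE. [cite: Andre1996Motifs, §6.3 proof of Lemme 6.3.1 (p. 32)]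
[cite: Milne2020HodgeClassesAV, Prop. 1 (p. 7)] -/
theorem liftDefect_eq_of_surjective (t : ComplexPoints S) (p : ℕ) :
    Module.finrank ℂ ↥(algebraicClasses (fiberOver (ψ ≫ f') t) p ⊓ LinearMap.range (complexBetti.map (fiberι (ψ ≫ f') t) (2 * p)).hom) +
        Module.finrank ℂ ↥((algebraicClasses 𝒳' p).map (complexBetti.map (fiberι f' t) (2 * p)).hom) =
      Module.finrank ℂ ↥(algebraicClasses (fiberOver f' t) p ⊓ LinearMap.range (complexBetti.map (fiberι f' t) (2 * p)).hom) +
        Module.finrank ℂ ↥((algebraicClasses 𝒳 p).map (complexBetti.map (fiberι (ψ ≫ f') t) (2 * p)).hom) := by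
  haveI := locallyQuasiFinite_left_of_isogenous hf hf'
  exact liftDefect_eq_of_isogenous hf hf' t p

end Summit.HodgeConjecture.HodgeConjecture.Ring2.AbelianAll

end
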